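import Mathlib.NumberTheory.LSeries.RiemannZeta
import Mathlib.Analysis.SpecialFunctions.Gamma.BohrMollerup
import Mathlib.Analysis.Complex.ExponentialBounds
import Literature.NumberTheory.LFunctions.RiemannXi
import Literature.NumberTheory.LFunctions.RiemannXiOrder
import Literature.NumberTheory.LFunctions.ZetaFractionalPartIntegral
import HarnessLib

/-!
# `ξ` is of order at most `1` (Titchmarsh 1986, Thm. 2.12, eq. (2.12.3)) — proved

Trunk T-NT-LFUNC (Literature/NumberTheory/LFunctions). Node L8 of the decomposition of
`Literature.NumberTheory.LFunctions.katkova_rh_iff_pf` (Katkova 2006, §1). We DISCHARGE the named fact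
`Literature.NumberTheory.LFunctions.riemannXi_order_le_one` (`RiemannXiOrder.lean`):

  `riemannXi_order_le_one_holds : ∃ A C, ∀ s, ‖ξ(s)‖ ≤ C · exp (A ‖s‖ log (1 + ‖s‖))`

(indeed with `A = 12`, `C = 8 e²⁶`), following Titchmarsh's three-line proof of (2.12.3),
p. 29: for `σ = re s ≥ 1/2` write `ξ(s) = ½ s(s-1) π^{-s/2} Γ(s/2) ζ(s)` and use
(i) `|Γ(s/2)| ≤ Γ(σ/2)` (the Euler integral) with the elementary `Γ(x) ≤ x^x` (`x ≥ 1`),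
`Γ(x) ≤ 1/x` (`0 < x ≤ 1`) from log-convexity (Mathlib `Real.convexOn_Gamma`) — this replaces
Stirling's (2.12.1); (ii) `ζ(s) = O(|s|)`-type bound `‖ζ(s)‖ ≤ ‖s‖/‖s-1‖ + ‖s‖/σ`, Titchmarsh
(2.12.2), proved in the tree as `Literature.NumberTheory.LFunctions.norm_riemannZeta_le_of_re_pos`
(`ZetaFractionalPartIntegral.lean`, from (2.1.4)); (iii) `|π^{-s/2}| ≤ 1`. For `σ < 1/2` the
functional equation `ξ(s) = ξ(1-s)` (`riemannXi_one_sub`) reduces to the first case.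

## Main results (all proved)

* `Literature.NumberTheory.LFunctions.norm_Gamma_le_Gamma_re` — `‖Γ(s)‖ ≤ Γ(re s)` for `re s > 0`.
* `Literature.NumberTheory.LFunctions.Real.Gamma_le_one_of_mem_Icc`, `Literature.NumberTheory.LFunctions.Real.Gamma_le_rpow_self`,
  `Literature.NumberTheory.LFunctions.Real.Gamma_le_of_quarter_le` — elementary bounds for the real `Γ`.
* `Literature.NumberTheory.LFunctions.norm_riemannXi_le_of_half_le_re` — `‖ξ(s)‖ ≤ 8e⁶ exp(4‖s‖ log(1+‖s‖))` for `re s ≥ 1/2`.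
* `Literature.riemannXi_order_le_one_holds : riemannXi_order_le_one`.

## References

* E. C. Titchmarsh, *The Theory of the Riemann Zeta-Function*, 2nd ed. (rev. D. R. Heath-Brown),
  Oxford 1986, §2.12, Thm. 2.12, eq. (2.12.1)–(2.12.3), p. 29.
-/

noncomputable section

open Complex MeasureTheory Set

namespace Literature.NumberTheory.LFunctions

/-! ### Bounds for `Γ` -/

/-- `‖Γ(s)‖ ≤ Γ(re s)` for `re s > 0` (take norms inside Euler's integral).
[Titchmarsh 1986, §2.12 (use of Stirling (2.12.1)); folklore] [folklore] -/
theorem norm_Gamma_le_Gamma_re {s : ℂ} (hs : 0 < s.re) : ‖Complex.Gamma s‖ ≤ Real.Gamma s.re := by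
  rw [Complex.Gamma_eq_integral hs, Complex.GammaIntegral, Real.Gamma_eq_integral hs]
  refine norm_integral_le_of_norm_le (Real.GammaIntegral_convergent hs) ?_
  rw [ae_restrict_iff' measurableSet_Ioi]
  refine Filter.Eventually.of_forall fun x (hx : 0 < x) => le_of_eq ?_
  rw [norm_mul, Complex.norm_of_nonneg (Real.exp_pos _).le,
    Complex.norm_cpow_eq_rpow_re_of_pos hx, Complex.sub_re, Complex.one_re]

/-- `Γ ≤ 1` on `[1, 2]` (log-convexity, `Γ(1) = Γ(2) = 1`). [folklore] -/
theorem Real.Gamma_le_one_of_mem_Icc {x : ℝ} (h1 : 1 ≤ x) (h2 : x ≤ 2) : Real.Gamma x ≤ 1 := by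
  have key := Real.convexOn_Gamma.2 (show (1 : ℝ) ∈ Ioi 0 by norm_num)
    (show (2 : ℝ) ∈ Ioi 0 by norm_num) (show 0 ≤ 2 - x by linarith) (show 0 ≤ x - 1 by linarith)
    (by ring)
  simp only [smul_eq_mul, Real.Gamma_one, Real.Gamma_two, mul_one] at key
  have hx : 2 - x + (x - 1) * 2 = x := by ring
  rw [hx] at key
  linarith

/-- `Γ(x) ≤ x^x` for `1 ≤ x ≤ n + 2` (induction on `n` via `Γ(x) = (x-1)Γ(x-1)`). [folklore] -/
theorem Real.Gamma_le_rpow_self_aux (n : ℕ) :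
    ∀ x : ℝ, 1 ≤ x → x ≤ n + 2 → Real.Gamma x ≤ x ^ x := by
  induction n with
  | zero =>
    intro x h1 h2
    calc Real.Gamma x ≤ 1 := Real.Gamma_le_one_of_mem_Icc h1 (by simpa using h2)
      _ ≤ x ^ x := Real.one_le_rpow h1 (by linarith)
  | succ n ih =>
    intro x h1 h2
    rcases le_or_gt x (n + 2) with h | h
    · exact ih x h1 h
    · have hx1 : 1 ≤ x - 1 := by
        have : (0 : ℝ) ≤ n := n.cast_nonneg
        linarith
      have hx2 : x - 1 ≤ n + 2 := by push_cast at h2; linarith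
      have hG := ih (x - 1) hx1 hx2
      have hne : x - 1 ≠ 0 := by linarith
      have hrec : Real.Gamma x = (x - 1) * Real.Gamma (x - 1) := by
        have := Real.Gamma_add_one hne
        rwa [sub_add_cancel] at this
      rw [hrec]
      calc (x - 1) * Real.Gamma (x - 1) ≤ (x - 1) * (x - 1) ^ (x - 1) :=
            mul_le_mul_of_nonneg_left hG (by linarith)
        _ = (x - 1) ^ x := by rw [Real.rpow_sub_one hne]; field_simp
        _ ≤ x ^ x := Real.rpow_le_rpow (by linarith) (by linarith) (by linarith)

/-- `Γ(x) ≤ x^x` for `x ≥ 1`. [folklore] -/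
theorem Real.Gamma_le_rpow_self {x : ℝ} (h1 : 1 ≤ x) : Real.Gamma x ≤ x ^ x := by
  obtain ⟨n, hn⟩ := exists_nat_ge x
  exact Real.Gamma_le_rpow_self_aux n x h1 (by linarith)

/-- A crude global bound: `Γ(x) ≤ 4 + exp(x log(1 + x))` for `x ≥ 1/4`. [folklore] -/
theorem Real.Gamma_le_of_quarter_le {x : ℝ} (hx : 1 / 4 ≤ x) :
    Real.Gamma x ≤ 4 + Real.exp (x * Real.log (1 + x)) := by
  have hexp := Real.exp_pos (x * Real.log (1 + x))
  rcases le_or_gt 1 x with h1 | h1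
  · calc Real.Gamma x ≤ x ^ x := Real.Gamma_le_rpow_self h1
      _ ≤ (1 + x) ^ x := Real.rpow_le_rpow (by linarith) (by linarith) (by linarith)
      _ = Real.exp (x * Real.log (1 + x)) := by
          rw [Real.rpow_def_of_pos (by linarith), mul_comm]
      _ ≤ 4 + Real.exp (x * Real.log (1 + x)) := by linarith
  · have hx0 : x ≠ 0 := by linarith
    have hxpos : 0 < x := by linarith
    have hG1 : Real.Gamma (x + 1) ≤ 1 := Real.Gamma_le_one_of_mem_Icc (by linarith) (by linarith)
    rw [Real.Gamma_add_one hx0] at hG1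
    have h1x : Real.Gamma x ≤ 1 / x := by
      rw [le_div_iff₀ hxpos, mul_comm]; exact hG1
    have h4 : 1 / x ≤ 4 := by
      rw [div_le_iff₀ hxpos]; linarith
    linarith

/-- `N ≤ 2 + N log(1 + N)` for `N ≥ 0` (since `log 3 > 1`). [folklore] -/
theorem le_two_add_mul_log {N : ℝ} (hN : 0 ≤ N) : N ≤ 2 + N * Real.log (1 + N) := by
  have hL : 0 ≤ Real.log (1 + N) := Real.log_nonneg (by linarith)
  rcases le_or_gt N 2 with h | h
  · nlinarith
  · have h1 : 1 ≤ Real.log (1 + N) := by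
      rw [Real.le_log_iff_exp_le (by linarith)]
      have := Real.exp_one_lt_three
      linarith
    nlinarith

/-- `log(1 + N) ≤ N` for `N ≥ 0`. [folklore] -/
theorem log_one_add_le_self {N : ℝ} (hN : 0 ≤ N) : Real.log (1 + N) ≤ N := by
  rw [Real.log_le_iff_le_exp (by linarith)]
  linarith [Real.add_one_le_exp N]

/-! ### The bound on `re s ≥ 1/2` -/

/-- **Titchmarsh (2.12.3) on the half-plane `σ ≥ 1/2`**, explicit:
`‖ξ(s)‖ ≤ 8 e⁶ · exp(4 ‖s‖ log(1 + ‖s‖))`. From `ξ(s) = ½ s(s-1) π^{-s/2} Γ(s/2) ζ(s)`,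
`|π^{-s/2}| ≤ 1`, `|Γ(s/2)| ≤ Γ(σ/2) ≤ 4 + e^{‖s‖ log(1+‖s‖)}` and (2.12.2)
`‖ζ(s)‖ ≤ ‖s‖/‖s-1‖ + ‖s‖/σ`. [cite: Titchmarsh1986, Thm. 2.12 eq. (2.12.3)] -/
theorem norm_riemannXi_le_of_half_le_re {s : ℂ} (hσ : 1 / 2 ≤ s.re) :
    ‖riemannXi s‖ ≤ 8 * Real.exp 6 * Real.exp (4 * ‖s‖ * Real.log (1 + ‖s‖)) := by
  set N : ℝ := ‖s‖ with hNdef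
  set L : ℝ := Real.log (1 + N) with hLdef
  have hN : 0 ≤ N := norm_nonneg _
  have hL : 0 ≤ L := Real.log_nonneg (by linarith)
  have hNL : 0 ≤ N * L := mul_nonneg hN hL
  have hE1 : 1 ≤ Real.exp (4 * N * L) := Real.one_le_exp (by positivity)
  have he6 : 1 ≤ Real.exp 6 := Real.one_le_exp (by norm_num)
  by_cases hs1 : s = 1
  · subst hs1
    rw [riemannXi_one]
    have : ‖(1 / 2 : ℂ)‖ = 1 / 2 := by simp
    rw [this]
    nlinarith
  have hs0 : s ≠ 0 := by
    rintro rfl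
    simp at hσ
    linarith
  have hσpos : 0 < s.re := by linarith
  -- the factorisation `ξ(s) = s(s-1)/2 · π^{-s/2} Γ(s/2) ζ(s)`
  have hΛ : completedRiemannZeta s = Gammaℝ s * riemannZeta s := by
    rw [riemannZeta_def_of_ne_zero hs0]
    field_simp [Gammaℝ_ne_zero_of_re_pos hσpos]
  have hξ : riemannXi s =
      s * (s - 1) / 2 * ((Real.pi : ℂ) ^ (-s / 2) * Complex.Gamma (s / 2) * riemannZeta s) := by
    rw [riemannXi_eq_mul_completedRiemannZeta hs0 hs1, hΛ, Gammaℝ_def]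
  -- the three factors
  have hpi : ‖(Real.pi : ℂ) ^ (-s / 2)‖ ≤ 1 := by
    rw [Complex.norm_cpow_eq_rpow_re_of_pos Real.pi_pos]
    refine Real.rpow_le_one_of_one_le_of_nonpos (by linarith [Real.two_le_pi]) ?_
    have : (-s / 2).re = -s.re / 2 := by simp [neg_div]
    rw [this]
    linarith
  have hΓ : ‖Complex.Gamma (s / 2)‖ ≤ 4 + Real.exp (N * L) := by
    have hre : (s / 2).re = s.re / 2 := by simp
    have h1 := norm_Gamma_le_Gamma_re (s := s / 2) (by rw [hre]; linarith)
    rw [hre] at h1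
    have h2 := Real.Gamma_le_of_quarter_le (x := s.re / 2) (by linarith)
    have h3 : s.re / 2 ≤ N := by
      have := Complex.re_le_norm s
      linarith
    have h4 : Real.exp (s.re / 2 * Real.log (1 + s.re / 2)) ≤ Real.exp (N * L) := by
      refine Real.exp_le_exp.2 (mul_le_mul h3 ?_ (Real.log_nonneg (by linarith)) hN)
      exact Real.log_le_log (by linarith) (by linarith)
    linarith
  have hs1' : 0 < ‖s - 1‖ := norm_pos_iff.2 (sub_ne_zero.2 hs1)
  have hζ : ‖riemannZeta s‖ ≤ N / ‖s - 1‖ + 2 * N := by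
    have h1 := Literature.NumberTheory.LFunctions.norm_riemannZeta_le_of_re_pos hσpos hs1
    have h2 : N / s.re ≤ 2 * N := by
      rw [div_le_iff₀ hσpos]
      nlinarith
    linarith
  -- combine
  have hnorm : ‖riemannXi s‖ =
      N * ‖s - 1‖ / 2 * (‖(Real.pi : ℂ) ^ (-s / 2)‖ * ‖Complex.Gamma (s / 2)‖ * ‖riemannZeta s‖) := by
    rw [hξ]
    simp only [norm_mul, norm_div, Complex.norm_two, hNdef]
  have hΓ0 : 0 ≤ ‖Complex.Gamma (s / 2)‖ := norm_nonneg _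
  have hζ0 : 0 ≤ ‖riemannZeta s‖ := norm_nonneg _
  have step1 : ‖riemannXi s‖ ≤
      N * ‖s - 1‖ / 2 * (1 * (4 + Real.exp (N * L)) * (N / ‖s - 1‖ + 2 * N)) := by
    rw [hnorm]
    gcongr
  have hs1le : ‖s - 1‖ ≤ N + 1 := by
    calc ‖s - 1‖ ≤ ‖s‖ + ‖(1 : ℂ)‖ := norm_sub_le _ _
      _ = N + 1 := by simp [hNdef]
  have step2 : N * ‖s - 1‖ / 2 * (1 * (4 + Real.exp (N * L)) * (N / ‖s - 1‖ + 2 * N)) =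
      (N * N + 2 * N * N * ‖s - 1‖) / 2 * (4 + Real.exp (N * L)) := by
    field_simp
  have hexpNL : 1 ≤ Real.exp (N * L) := Real.one_le_exp hNL
  have step3 : (N * N + 2 * N * N * ‖s - 1‖) / 2 * (4 + Real.exp (N * L)) ≤
      (3 * N ^ 2 + 2 * N ^ 3) / 2 * (5 * Real.exp (N * L)) := by
    have ha : N * N + 2 * N * N * ‖s - 1‖ ≤ 3 * N ^ 2 + 2 * N ^ 3 := by nlinarith
    have hb : 4 + Real.exp (N * L) ≤ 5 * Real.exp (N * L) := by linarith
    have ha0 : 0 ≤ N * N + 2 * N * N * ‖s - 1‖ := by positivity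
    have hb0 : 0 ≤ 4 + Real.exp (N * L) := by positivity
    have hc0 : (0 : ℝ) ≤ 3 * N ^ 2 + 2 * N ^ 3 := by positivity
    calc (N * N + 2 * N * N * ‖s - 1‖) / 2 * (4 + Real.exp (N * L))
        ≤ (3 * N ^ 2 + 2 * N ^ 3) / 2 * (4 + Real.exp (N * L)) := by gcongr
      _ ≤ (3 * N ^ 2 + 2 * N ^ 3) / 2 * (5 * Real.exp (N * L)) := by gcongr
  -- `3N² + 2N³ ≤ 3(1+N)³ ≤ 3 e^{3N} ≤ 3 e⁶ e^{3NL}`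
  have hpoly : 3 * N ^ 2 + 2 * N ^ 3 ≤ 3 * Real.exp 6 * Real.exp (3 * (N * L)) := by
    have h1 : 3 * N ^ 2 + 2 * N ^ 3 ≤ 3 * (N + 1) ^ 3 := by nlinarith
    have h2 : (N + 1) ^ 3 ≤ Real.exp N ^ 3 :=
      pow_le_pow_left₀ (by linarith) (Real.add_one_le_exp N) 3
    have h3 : Real.exp N ^ 3 = Real.exp (3 * N) := by rw [← Real.exp_nat_mul]; norm_num
    have h4 : Real.exp (3 * N) ≤ Real.exp 6 * Real.exp (3 * (N * L)) := by
      rw [← Real.exp_add]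
      exact Real.exp_le_exp.2 (by linarith [le_two_add_mul_log hN])
    nlinarith [Real.exp_pos N]
  have step4 : (3 * N ^ 2 + 2 * N ^ 3) / 2 * (5 * Real.exp (N * L)) ≤
      3 * Real.exp 6 * Real.exp (3 * (N * L)) / 2 * (5 * Real.exp (N * L)) := by
    gcongr
  have step5 : 3 * Real.exp 6 * Real.exp (3 * (N * L)) / 2 * (5 * Real.exp (N * L)) =
      15 / 2 * Real.exp 6 * Real.exp (4 * N * L) := by
    have : Real.exp (4 * N * L) = Real.exp (3 * (N * L)) * Real.exp (N * L) := by
      rw [← Real.exp_add]; ring_nf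
    rw [this]; ring
  have hfin : 15 / 2 * Real.exp 6 * Real.exp (4 * N * L) ≤ 8 * Real.exp 6 * Real.exp (4 * N * L) := by
    nlinarith [Real.exp_pos 6, Real.exp_pos (4 * N * L)]
  linarith

/-! ### Discharge of the named fact -/

/-- **Titchmarsh 1986, Thm. 2.12, eq. (2.12.3)** — `ξ` is of order at most `1`:
`‖ξ(s)‖ ≤ C exp(A ‖s‖ log(1 + ‖s‖))` for all `s` (with `A = 12`, `C = 8 e²⁶`). Discharges the
named fact `Literature.NumberTheory.LFunctions.riemannXi_order_le_one`. [cite: Titchmarsh1986, Thm. 2.12 eq. (2.12.3)] -/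
theorem riemannXi_order_le_one_holds : riemannXi_order_le_one := by
  refine ⟨12, 8 * Real.exp 6 * Real.exp 20, fun s => ?_⟩
  set N : ℝ := ‖s‖ with hNdef
  have hN : 0 ≤ N := norm_nonneg _
  set L : ℝ := Real.log (1 + N) with hLdef
  have hL : 0 ≤ L := Real.log_nonneg (by linarith)
  have hNL : 0 ≤ N * L := mul_nonneg hN hL
  have he20 : 1 ≤ Real.exp 20 := Real.one_le_exp (by norm_num)
  rcases le_or_gt (1 / 2 : ℝ) s.re with hσ | hσ
  · have h := norm_riemannXi_le_of_half_le_re hσ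
    have h1 : Real.exp (4 * N * L) ≤ Real.exp (12 * N * L) := Real.exp_le_exp.2 (by nlinarith)
    calc ‖riemannXi s‖ ≤ 8 * Real.exp 6 * Real.exp (4 * N * L) := h
      _ ≤ 8 * Real.exp 6 * (Real.exp 20 * Real.exp (12 * N * L)) := by
          gcongr
          calc Real.exp (4 * N * L) ≤ Real.exp (12 * N * L) := h1
            _ = 1 * Real.exp (12 * N * L) := (one_mul _).symm
            _ ≤ Real.exp 20 * Real.exp (12 * N * L) := by gcongr
      _ = 8 * Real.exp 6 * Real.exp 20 * Real.exp (12 * N * L) := by ring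
  · -- functional equation: `ξ(s) = ξ(1 - s)`, `re (1 - s) > 1/2`
    have hσ' : 1 / 2 ≤ (1 - s).re := by
      simp only [Complex.sub_re, Complex.one_re]
      linarith
    have h := norm_riemannXi_le_of_half_le_re hσ'
    rw [riemannXi_one_sub] at h
    set N' : ℝ := ‖1 - s‖ with hN'def
    have hN'0 : 0 ≤ N' := norm_nonneg _
    have hN' : N' ≤ 1 + N := by
      calc ‖1 - s‖ ≤ ‖(1 : ℂ)‖ + ‖s‖ := norm_sub_le _ _
        _ = 1 + N := by simp [hNdef]
    have hlog2 : Real.log (1 + N') ≤ 1 + L := by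
      calc Real.log (1 + N') ≤ Real.log (2 * (1 + N)) :=
            Real.log_le_log (by linarith) (by linarith)
        _ = Real.log 2 + L := by rw [Real.log_mul (by norm_num) (by linarith)]
        _ ≤ 1 + L := by linarith [Real.log_two_lt_d9]
    have hkey : N' * Real.log (1 + N') ≤ 5 + 3 * (N * L) := by
      have h1 : N' * Real.log (1 + N') ≤ (1 + N) * (1 + L) :=
        mul_le_mul hN' hlog2 (Real.log_nonneg (by linarith)) (by linarith)
      have h2 : L ≤ N := log_one_add_le_self hN
      have h3 : N ≤ 2 + N * L := le_two_add_mul_log hN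
      nlinarith
    have hexp : Real.exp (4 * N' * Real.log (1 + N')) ≤ Real.exp 20 * Real.exp (12 * N * L) := by
      rw [← Real.exp_add]
      exact Real.exp_le_exp.2 (by nlinarith)
    calc ‖riemannXi s‖ ≤ 8 * Real.exp 6 * Real.exp (4 * N' * Real.log (1 + N')) := h
      _ ≤ 8 * Real.exp 6 * (Real.exp 20 * Real.exp (12 * N * L)) := by
          gcongr
      _ = 8 * Real.exp 6 * Real.exp 20 * Real.exp (12 * N * L) := by ring

end Literature.NumberTheory.LFunctions
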